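import Mathlib
import Literature.Analysis.FluidPDE.VectorCalculus
import Literature.Analysis.FluidPDE.LocalTypeI
import Summits.NavierStokesRegularity.NavierStokesRegularity.Theorems.RootDecompLitSliceDarkBallSpreadsNullSetComplementConnected
import Summits.NavierStokesRegularity.NavierStokesRegularity.Theorems.RootDecompLitSliceDarkBallSpreadsComplConnected
import Summits.NavierStokesRegularity.NavierStokesRegularity.Theorems.RootDecompLitSliceDarkBallSpreadsHarmonicContinuation
import HarnessLib

/-!
# Route RootDecompLitSlice — brick «PROPAGATION» of the aside D₁ `DarkBallSpreads`
  (stmt-NavierStokesRegularity-29566, the registered stub `stub_darkBallSpreads` of crux D `NoDarkBall`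
  stmt-NavierStokesRegularity-29563): **irrotationality spreads along the connected regular slice**

The assembled tail of D₁ (bricks B0/B2/B5/B6′/B6″, in the tree) closes `DarkBallSpreads` from the interface
`H_B1B3B4 := ∃ w, ContDiffOn ℝ 2 w Σ_Tᶜ ∧ (∀ x ∈ Σ_Tᶜ, curl w x = 0) ∧ (∀ x ∈ Σ_Tᶜ, div w x = 0) ∧
TendstoLocallyUniformlyOn u w (𝓝[<] T) Σ_Tᶜ` (critic decomp-ns-crit-1 g8, bus L1183 (P2‴)), where
`Σ_T = {x | IsBackwardSingularPoint u (T, x)}` is the backward-singular set of the terminal slice. Its only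
hard clause is `curl w = 0` on ALL of `Σ_Tᶜ`. This file isolates the TOPOLOGICAL half of that clause and
proves it: irrotationality near ONE regular point propagates to the whole regular slice, GIVEN the local
analytic step

  `LOCAL SPREAD at x₀ ∈ Σ_Tᶜ`: there is `ρ > 0` such that for every regular `x₁` with `dist x₁ x₀ < ρ`,
  if `curl w` vanishes near `x₁` then it vanishes near `x₀`

— which is exactly what bricks B1 (regular-point smoothing up to `T`, census p803318 + part 2), B3
(flatness ⟹ vanishing to infinite parabolic order of the vorticity at `(T, x₁)`) and B4 (the PROVED
Escauriaza–Seregin–Šverák unique continuation `Literature.Analysis.FluidPDE.ess_unique_continuation_holds`,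
applied to the time-reversed, translated, viscosity-normalised vorticity on the cylinder
`B_{r/2}(x₁) × (T − r²/4, T) ⊆ Q_r(T, x₀)`, which contains `x₀` when `dist x₁ x₀ < r/2 =: ρ`) deliver:
the output of ESS is `curl w = 0` on the open ball `B_{r/2}(x₁) ∋ x₀`.

Contents (no PDE, no new definitions):
* `eventually_nhds_of_localSpread_of_isPreconnected` — ABSTRACT PROPAGATION in a pseudo-metric space: on a
  preconnected set `V`, a germ property `∀ᶠ y in 𝓝 x, P y` that holds at one point of `V` and satisfies the
  local spread step at every point of `V` holds at every point of `V` (open–closed argument run through the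
  definition of `IsPreconnected`; `V` need not be open);
* `eventually_curl_eq_zero_of_eventuallyEq_zero` — `curl` is local: `w = 0` near `a` ⟹ `curl w = 0` near `a`;
* `nonempty_ball_inter_compl_of_hausdorffMeasure_one_eq_zero` — a ball meets the complement of an
  `ℋ¹`-null set (Lebesgue nullity, brick B6′ file);
* `exists_seed_of_darkBall` — the SEED: if `w = 0` on `B(x₀, ρ) ∖ Σ_t` (the dark-ball reading of B2,
  `lerayHopf_limit_eqOn_zero_of_darkBall`) and `ℋ¹(Σ_t) = 0` (B0) then `curl w` vanishes near some regular
  point;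
* `curl_eq_zero_compl_backwardSingularSlice_of_localSpread` — PROPAGATION on the regular slice
  (preconnectedness from B5 + B0);
* `curl_eq_zero_compl_backwardSingularSlice_of_darkBall` — SEED + PROPAGATION packaged: under B0's
  nullity, the dark-ball reading and the local spread step, `curl w = 0` on all of `Σ_tᶜ` — the `hcurl`
  input of `ae_eq_zero_of_ae_eq_curlFree_divFree_off_backwardSingularSlice_of_darkBall` (B6″ file).

HONEST FRAMING: bookkeeping about a HYPOTHETICAL singular time; closes no item (the local spread step —
B1 part 2, B3, B4 — remains with the census); decorative for the summit per D-0179 (D is an expected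
theorem; N16's residual U 29565 / N20's M₂ are the summit-hard leaves); nothing here bears on NS
regularity (rung 0). Lands `--supports stmt-NavierStokesRegularity-29566 --as helper`
(decomp-ns route-writer g16). [folklore]
-/

noncomputable section

open MeasureTheory Set Function Filter Topology Metric
open scoped ENNReal
open Literature.Analysis.FluidPDE

-- the summit and its single sub-problem share the name (CONVENTIONS §1), as in every Theorems file
set_option linter.dupNamespace false

namespace Summit.NavierStokesRegularity.NavierStokesRegularity.Theorems

/-! ## §1 Abstract propagation of a germ property along a preconnected set -/

section Abstract

variable {X : Type*} [PseudoMetricSpace X]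

/-- **Open–closed propagation.** Let `V` be preconnected and `P` a pointwise property. Suppose the LOCAL
SPREAD step holds at every `x₀ ∈ V`: for some `ρ > 0`, whenever `P` holds near a point `x₁ ∈ V` with
`dist x₁ x₀ < ρ`, it holds near `x₀`. If `P` holds near one point of `V`, it holds near every point of
`V`. (The set of points near which `P` holds is open; the step makes its trace on `V` relatively closed.)
[folklore] -/
theorem eventually_nhds_of_localSpread_of_isPreconnected {V : Set X} (hV : IsPreconnected V)
    {P : X → Prop}
    (hstep : ∀ x₀ ∈ V, ∃ ρ > 0, ∀ x₁ ∈ V, dist x₁ x₀ < ρ →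
      (∀ᶠ y in 𝓝 x₁, P y) → ∀ᶠ y in 𝓝 x₀, P y)
    {a : X} (ha : a ∈ V) (hPa : ∀ᶠ y in 𝓝 a, P y) :
    ∀ x ∈ V, ∀ᶠ y in 𝓝 x, P y := by
  set U : Set X := {x | ∀ᶠ y in 𝓝 x, P y} with hU_def
  have hU : IsOpen U := by
    rw [hU_def, isOpen_iff_mem_nhds]
    intro x hx
    exact (eventually_eventually_nhds.2 hx).mono fun y hy => hy
  -- points of `V` adherent to `V ∩ U` lie in `U` (the local spread step)
  have hkey : ∀ x₀ ∈ V, x₀ ∈ closure (V ∩ U) → x₀ ∈ U := by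
    intro x₀ hx₀ hcl
    obtain ⟨ρ, hρ, hρstep⟩ := hstep x₀ hx₀
    obtain ⟨x₁, hx₁, hd⟩ := Metric.mem_closure_iff.1 hcl ρ hρ
    rw [dist_comm] at hd
    exact hρstep x₁ hx₁.1 hd hx₁.2
  -- the open set avoiding the closure of `V ∩ U`
  set W : Set X := (closure (V ∩ U))ᶜ with hW_def
  have hW : IsOpen W := isClosed_closure.isOpen_compl
  have hcover : V ⊆ U ∪ W := by
    intro x hx
    by_cases hcl : x ∈ closure (V ∩ U)
    · exact Or.inl (hkey x hx hcl)
    · exact Or.inr hcl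
  have hVU : (V ∩ U).Nonempty := ⟨a, ha, hPa⟩
  intro x hx
  by_contra hxU
  have hxW : x ∈ W := fun hcl => hxU (hkey x hx hcl)
  obtain ⟨z, hzV, hzU, hzW⟩ := hV U W hU hW hcover hVU ⟨x, hx, hxW⟩
  exact hzW (subset_closure ⟨hzV, hzU⟩)

/-- Pointwise corollary of `eventually_nhds_of_localSpread_of_isPreconnected`. [folklore] -/
theorem forall_of_localSpread_of_isPreconnected {V : Set X} (hV : IsPreconnected V)
    {P : X → Prop}
    (hstep : ∀ x₀ ∈ V, ∃ ρ > 0, ∀ x₁ ∈ V, dist x₁ x₀ < ρ →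
      (∀ᶠ y in 𝓝 x₁, P y) → ∀ᶠ y in 𝓝 x₀, P y)
    {a : X} (ha : a ∈ V) (hPa : ∀ᶠ y in 𝓝 a, P y) :
    ∀ x ∈ V, P x :=
  fun x hx => (eventually_nhds_of_localSpread_of_isPreconnected hV hstep ha hPa x hx).self_of_nhds

end Abstract

/-! ## §2 Locality of `curl` and the dark-ball seed -/

section Seed

/-- **`curl` is local at the germ level**: a field vanishing near `a` has vanishing curl near `a`
(`curl` reads only `fderiv`, and `fderiv` of a germ-zero field is zero). [folklore] -/
theorem eventually_curl_eq_zero_of_eventuallyEq_zero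
    {w : EuclideanSpace ℝ (Fin 3) → EuclideanSpace ℝ (Fin 3)} {a : EuclideanSpace ℝ (Fin 3)}
    (h : w =ᶠ[𝓝 a] (fun _ => 0)) : ∀ᶠ y in 𝓝 a, curl w y = 0 := by
  filter_upwards [h.eventuallyEq_nhds] with y hy
  have hf : fderiv ℝ w y = 0 := by
    rw [hy.fderiv_eq]
    exact fderiv_const_apply (0 : EuclideanSpace ℝ (Fin 3))
  ext i
  fin_cases i <;> simp [curl, hf]

/-- A field that vanishes on an open set has vanishing curl near each of its points. [folklore] -/
theorem eventually_curl_eq_zero_of_eqOn_zero_of_isOpen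
    {w : EuclideanSpace ℝ (Fin 3) → EuclideanSpace ℝ (Fin 3)} {O : Set (EuclideanSpace ℝ (Fin 3))}
    (hO : IsOpen O) (hw : EqOn w 0 O) {a : EuclideanSpace ℝ (Fin 3)} (ha : a ∈ O) :
    ∀ᶠ y in 𝓝 a, curl w y = 0 :=
  eventually_curl_eq_zero_of_eventuallyEq_zero
    (Filter.eventuallyEq_of_mem (hO.mem_nhds ha) fun y hy => by simpa using hw hy)

/-- **A ball meets the complement of an `ℋ¹`-null set of `ℝ³`** (the null set is Lebesgue-null,
`volume_eq_zero_of_hausdorffMeasure_one_eq_zero`, while balls have positive volume). [folklore] -/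
theorem nonempty_ball_inter_compl_of_hausdorffMeasure_one_eq_zero
    {S : Set (EuclideanSpace ℝ (Fin 3))} (hnull : μH[1] S = 0)
    (x₀ : EuclideanSpace ℝ (Fin 3)) {ρ : ℝ} (hρ : 0 < ρ) : (ball x₀ ρ ∩ Sᶜ).Nonempty := by
  by_contra hne
  rw [Set.not_nonempty_iff_eq_empty] at hne
  have hsub : ball x₀ ρ ⊆ S := by
    intro y hy
    by_contra hyS
    have : y ∈ ball x₀ ρ ∩ Sᶜ := ⟨hy, hyS⟩
    rw [hne] at this
    exact this
  have hpos : 0 < volume (ball x₀ ρ) := measure_ball_pos volume x₀ hρ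
  have hle : volume (ball x₀ ρ) ≤ volume S := measure_mono hsub
  rw [volume_eq_zero_of_hausdorffMeasure_one_eq_zero hnull] at hle
  exact hpos.ne' (nonpos_iff_eq_zero.1 hle)

/-- **The dark-ball seed.** On the slice `Σ_t = {x | IsBackwardSingularPoint u (t, x)}` (closed; assumed
`ℋ¹`-null — brick B0 for the terminal slice of a Clay-class solution): if the field `w` vanishes on
`B(x₀, ρ) ∖ Σ_t` (the dark-ball reading of brick B2, `lerayHopf_limit_eqOn_zero_of_darkBall`), then
`curl w` vanishes near some regular point. [folklore] -/
theorem exists_seed_of_darkBall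
    (u : ℝ → (EuclideanSpace ℝ (Fin 3)) → (EuclideanSpace ℝ (Fin 3))) (t : ℝ)
    (hnull : μH[1] {x : EuclideanSpace ℝ (Fin 3) | IsBackwardSingularPoint u (t, x)} = 0)
    {w : EuclideanSpace ℝ (Fin 3) → EuclideanSpace ℝ (Fin 3)}
    {x₀ : EuclideanSpace ℝ (Fin 3)} {ρ : ℝ} (hρ : 0 < ρ)
    (hdark : EqOn w 0 (ball x₀ ρ ∩ {x : EuclideanSpace ℝ (Fin 3) | IsBackwardSingularPoint u (t, x)}ᶜ)) :
    ∃ a ∈ {x : EuclideanSpace ℝ (Fin 3) | IsBackwardSingularPoint u (t, x)}ᶜ,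
      ∀ᶠ y in 𝓝 a, curl w y = 0 := by
  obtain ⟨a, ha⟩ := nonempty_ball_inter_compl_of_hausdorffMeasure_one_eq_zero hnull x₀ hρ
  exact ⟨a, ha.2, eventually_curl_eq_zero_of_eqOn_zero_of_isOpen
    (isOpen_ball.inter (isClosed_backwardSingularSlice u t).isOpen_compl) hdark ha⟩

end Seed

/-! ## §3 Propagation on the regular slice -/

section Slice

/-- **PROPAGATION (regular slice).** Let `Σ_t = {x | IsBackwardSingularPoint u (t, x)}` have preconnected
complement (bricks B5 + B0: `ℋ¹(Σ_t) = 0` ⟹ `Σ_tᶜ` path-connected), and let `w` satisfy the LOCAL SPREAD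
step on `Σ_tᶜ` (bricks B1 + B3 + B4: ESS unique continuation in regular backward cylinders). If `curl w`
vanishes near one regular point then `curl w = 0` on all of `Σ_tᶜ`. [folklore] -/
theorem curl_eq_zero_compl_backwardSingularSlice_of_localSpread
    (u : ℝ → (EuclideanSpace ℝ (Fin 3)) → (EuclideanSpace ℝ (Fin 3))) (t : ℝ)
    (hconn : IsPreconnected {x : EuclideanSpace ℝ (Fin 3) | IsBackwardSingularPoint u (t, x)}ᶜ)
    {w : EuclideanSpace ℝ (Fin 3) → EuclideanSpace ℝ (Fin 3)}
    (hstep : ∀ x₀ ∈ {x : EuclideanSpace ℝ (Fin 3) | IsBackwardSingularPoint u (t, x)}ᶜ, ∃ ρ > 0,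
      ∀ x₁ ∈ {x : EuclideanSpace ℝ (Fin 3) | IsBackwardSingularPoint u (t, x)}ᶜ, dist x₁ x₀ < ρ →
        (∀ᶠ y in 𝓝 x₁, curl w y = 0) → ∀ᶠ y in 𝓝 x₀, curl w y = 0)
    (hseed : ∃ a ∈ {x : EuclideanSpace ℝ (Fin 3) | IsBackwardSingularPoint u (t, x)}ᶜ,
      ∀ᶠ y in 𝓝 a, curl w y = 0) :
    ∀ x ∈ {x : EuclideanSpace ℝ (Fin 3) | IsBackwardSingularPoint u (t, x)}ᶜ, curl w x = 0 := by
  obtain ⟨a, ha, hPa⟩ := hseed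
  exact forall_of_localSpread_of_isPreconnected hconn hstep ha hPa

/-- Germ form of `curl_eq_zero_compl_backwardSingularSlice_of_localSpread`: `curl w` vanishes NEAR every
regular point (useful when the divergence clause is read off the same neighbourhoods). [folklore] -/
theorem eventually_curl_eq_zero_compl_backwardSingularSlice_of_localSpread
    (u : ℝ → (EuclideanSpace ℝ (Fin 3)) → (EuclideanSpace ℝ (Fin 3))) (t : ℝ)
    (hconn : IsPreconnected {x : EuclideanSpace ℝ (Fin 3) | IsBackwardSingularPoint u (t, x)}ᶜ)
    {w : EuclideanSpace ℝ (Fin 3) → EuclideanSpace ℝ (Fin 3)}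
    (hstep : ∀ x₀ ∈ {x : EuclideanSpace ℝ (Fin 3) | IsBackwardSingularPoint u (t, x)}ᶜ, ∃ ρ > 0,
      ∀ x₁ ∈ {x : EuclideanSpace ℝ (Fin 3) | IsBackwardSingularPoint u (t, x)}ᶜ, dist x₁ x₀ < ρ →
        (∀ᶠ y in 𝓝 x₁, curl w y = 0) → ∀ᶠ y in 𝓝 x₀, curl w y = 0)
    (hseed : ∃ a ∈ {x : EuclideanSpace ℝ (Fin 3) | IsBackwardSingularPoint u (t, x)}ᶜ,
      ∀ᶠ y in 𝓝 a, curl w y = 0) :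
    ∀ x ∈ {x : EuclideanSpace ℝ (Fin 3) | IsBackwardSingularPoint u (t, x)}ᶜ,
      ∀ᶠ y in 𝓝 x, curl w y = 0 := by
  obtain ⟨a, ha, hPa⟩ := hseed
  exact eventually_nhds_of_localSpread_of_isPreconnected hconn hstep ha hPa

/-- **SEED + PROPAGATION, D₁-facing form.** For any field `u` and time `t` with `ℋ¹(Σ_t) = 0` (B0 for the
terminal slice), any `w` vanishing on `B(x₀, ρ) ∖ Σ_t` (B2 dark-ball reading) and satisfying the local
spread step on `Σ_tᶜ` (B1 + B3 + B4): `curl w = 0` on `Σ_tᶜ` — the `hcurl` input of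
`ae_eq_zero_of_ae_eq_curlFree_divFree_off_backwardSingularSlice_of_darkBall`. Preconnectedness of `Σ_tᶜ` is
supplied here from B5 (`isPathConnected_compl_of_hausdorffMeasure_eq_zero` with
`isClosed_backwardSingularSlice`). [folklore] -/
theorem curl_eq_zero_compl_backwardSingularSlice_of_darkBall
    (u : ℝ → (EuclideanSpace ℝ (Fin 3)) → (EuclideanSpace ℝ (Fin 3))) (t : ℝ)
    (hnull : μH[1] {x : EuclideanSpace ℝ (Fin 3) | IsBackwardSingularPoint u (t, x)} = 0)
    {w : EuclideanSpace ℝ (Fin 3) → EuclideanSpace ℝ (Fin 3)}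
    (hstep : ∀ x₀ ∈ {x : EuclideanSpace ℝ (Fin 3) | IsBackwardSingularPoint u (t, x)}ᶜ, ∃ ρ > 0,
      ∀ x₁ ∈ {x : EuclideanSpace ℝ (Fin 3) | IsBackwardSingularPoint u (t, x)}ᶜ, dist x₁ x₀ < ρ →
        (∀ᶠ y in 𝓝 x₁, curl w y = 0) → ∀ᶠ y in 𝓝 x₀, curl w y = 0)
    {x₀ : EuclideanSpace ℝ (Fin 3)} {ρ : ℝ} (hρ : 0 < ρ)
    (hdark : EqOn w 0 (ball x₀ ρ ∩ {x : EuclideanSpace ℝ (Fin 3) | IsBackwardSingularPoint u (t, x)}ᶜ)) :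
    ∀ x ∈ {x : EuclideanSpace ℝ (Fin 3) | IsBackwardSingularPoint u (t, x)}ᶜ, curl w x = 0 :=
  curl_eq_zero_compl_backwardSingularSlice_of_localSpread u t
    (isPathConnected_compl_backwardSingularSlice_of_hausdorffMeasure_eq_zero u t
      hnull).isConnected.isPreconnected
    hstep (exists_seed_of_darkBall u t hnull hρ hdark)

end Slice

end Summit.NavierStokesRegularity.NavierStokesRegularity.Theorems
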